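import Literature.NumberTheory.EllipticCurves.CyclotomicIwasawaMainTheoremIrreducibleBaseChangeProofs
import Literature.NumberTheory.EllipticCurves.ModularityVersionApProofs
import HarnessLib

/-!
# bsd.S21′ — the auxiliary fields of Burungale–Castella–Skinner, Lemma 5.2.3, and Thm. 1.1.2 (a) from Prop. 5.2.1

Second `Proofs` companion (theorems only: no definition, no named fact) of
`Literature.NumberTheory.EllipticCurves.CyclotomicIwasawaMainTheoremIrreducible`, sequel of
`CyclotomicIwasawaMainTheoremIrreducibleBaseChangeProofs`, for the named fact
`Literature.NumberTheory.EllipticCurves.burungale_castella_skinner_charIdeal_eq_padicLFunction`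
(**bsd.S21′**; A. Burungale, F. Castella, C. Skinner, *Base change and Iwasawa main conjectures
for `GL₂`*, Int. Math. Res. Not. IMRN 2025, no. 8, rnaf082 = arXiv:2405.00270v2, Thm. 1.1.2 (a),
p. 2).

## What this file proves

The printed proof of Thm. 1.1.2 (p. 10 of arXiv:2405.00270v2) reads: "Pick an imaginary quadratic
field `K` and a real quadratic field `F` as in Lemma 5.2.3. Then by Proposition 5.2.1, [(5.2)]. By
[CGS23, Prop. 1.2.4] and Propositions 3.6 and 3.9 in [SU14] … from (5.2) we get the divisibilities
[(5.3)] … On the other hand, by [Kat04, Thm. 17.4] we have the divisibility [(5.4)] … Noting that a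
proper divisibility in (5.4) would contradict (5.3), the proof concludes." The previous file took
the whole of "(5.3) for SOME auxiliary pair `(K, F)`" as one hypothesis. This file separates the
two printed ingredients of that sentence, following the lemma structure of §5.2:

* **Lemma 5.2.3 (existence of the auxiliary fields), arithmetic content — PROVED.** For the
  hypotheses of Prop. 5.2.1 (p. 9) on the pair `(K, F)` that are conditions on the discriminants
  `d_K < 0 < d_F` — (disc) `D_K` odd and `≠ -3`; (Heeg) every `ℓ ∣ N` splits in `K`; (spl) `p`
  splits in `K`; (i) `p` inert in `F`; (ii) `D_F` odd and every prime dividing `D_F` splits in `K`;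
  (iii) every `ℓ ∣ N` is inert in `F` if `ℓ ≡ -1 (mod p)` and split otherwise; (vi) `F ≠ ℚ(ζ₅)⁺`
  if `p = 5` — written, as in `HeegnerHypothesisKroneckerProofs` (`satisfiesHeegnerHypothesis_iff_kronecker`:
  a prime `ℓ` splits in `ℚ(√d)` iff `d ≡ 1 (mod 8)` for `ℓ = 2`, resp. `(d/ℓ) = 1` for odd `ℓ`,
  and is inert iff `d ≡ 5 (mod 8)`, resp. `(d/ℓ) = -1`; Marcus, *Number Fields*, Ch. 3, Thm. 25),
  through Kronecker symbols of the fundamental discriminants `d_K ≡ d_F ≡ 1 (mod 4)`: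
  `exists_auxiliaryImaginaryQuadraticDiscr` and `exists_auxiliaryRealQuadraticDiscr` produce such
  `d_K = -q'` and `d_F = q` (primes `q' ≡ -1 (mod 8pN)`, and `q` in a residue class modulo
  `8 p |d_K| ∏_{ℓ ∣ N} ℓ` assembled by the Chinese remainder theorem from quadratic non-residues),
  OUTSIDE ANY GIVEN FINITE SETS, by Dirichlet's theorem on primes in arithmetic progressions
  (Mathlib's `Nat.forall_exists_prime_gt_and_eq_mod`) — the source's "independent splitting
  conditions which hold for a positive proportion of [quadratic fields]" in the weaker form
  "hold for infinitely many", which is all the proof uses.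
* **Prop. 5.2.1 ⟹ (5.3), as the remaining hypothesis `h521`.** The Galois-theoretic hypotheses
  of Prop. 5.2.1 — (irr_K) `ρ̄|_{G_K}` irreducible, (iv) (irr_M) for `M = FK`, (v)
  `ρ̄|_{G_{F(ζ_p)}}` irreducible — are, by the proof of Lemma 5.2.3 (p. 10: "In view of (irr_K),
  if `FK` is not a subfield of the splitting field of `ρ_g|_{G_K}`, then (irr_M) holds for
  `M = FK`. For such `F`, if `ρ̄_g|_{G_{F(ζ_p)}}` is reducible, then … this forces `p = 5` and
  `F = ℚ(ζ₅)⁺`"), violated by at most finitely many `K` (the `≤ 3` quadratic fields from which an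
  irreducible odd `ρ̄` can be induced) and, for each admissible `K`, by at most finitely many `F`
  (the real quadratic subfields of `ℚ(E[p]) · K`, and `ℚ(√5)` if `p = 5`). Accordingly `h521`
  states display (5.3) — in the tree's vocabulary exactly as in the previous file (four globally
  minimal models, their newforms and Pontryagin-dual data, `p`-power slack as in `PAdicBSD`) — for
  ALL discriminants `d_K ∉ X₁`, `d_F ∉ X₂` satisfying the arithmetic hypotheses above, for SOME
  finite exceptional sets `X₁` and `X₂ = X₂(d_K)` of integers. This is a consequence of Prop. 5.2.1,
  the passage (5.2) ⟹ (5.3) ([CGS23, Prop. 1.2.4], [SU14, Props. 3.6, 3.9]) and the quoted lines of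
  the proof of Lemma 5.2.3, all as printed; it is the base-change half of the theorem (Wan's
  `U(3,1)` divisibility over the quartic CM field `M = FK`, Hida theory, `Λ`-adic control), which
  is not in Mathlib or the tree and is NOT asserted here.
* **The closure** `burungale_castella_skinner_charIdeal_eq_padicLFunction_of_prop521`: the named
  fact from Kato's divisibility for every curve (`kato_divisibility`, the tree's named fact =
  (5.4)), modularity (`exists_isNewformOf`, for the newforms of the three twists) and `h521`,
  choosing `d_K`, then `d_F`, by the two existence theorems and then arguing exactly as in
  `burungale_castella_skinner_charIdeal_eq_padicLFunction_of_baseChange_divisibility`.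

Here `N = N_E` is the conductor of `E` (`W.conductorNorm ℤ`; p. 2: "Let `N` be the conductor of
`E`"), and `p ∤ N` because `p` is a prime of good reduction
(`WeierstrassCurve.dvd_conductorNorm_iff_not_hasGoodReductionAtPrime`).

## References

* A. Burungale, F. Castella, C. Skinner, IMRN 2025 (8), rnaf082 = arXiv:2405.00270v2: Thm. 1.1.2
  (p. 2), (disc)/(Heeg)/(spl) (p. 2), (irr_K) (p. 7), Prop. 5.2.1 and its hypotheses (i)–(vi)
  (p. 9), Lemma 5.2.3 and "Proof of Theorem 1.1.2", (5.2)–(5.4) (p. 10). [BurungaleCastellaSkinner2025]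
* K. Kato, Astérisque 295 (2004), Thm. 17.4. [Kato2004Asterisque]
* D. A. Marcus, *Number Fields*, Ch. 3, Thm. 25 (decomposition law in quadratic fields). [Marcus2018]
* K. Ireland, M. Rosen, *A Classical Introduction to Modern Number Theory*, 2nd ed., Ch. 5 §2
  (Jacobi symbol), Ch. 16 Thm. 1 (Dirichlet's theorem). [IrelandRosen1990]

## Design

Theorems only, `namespace Literature.NumberTheory.EllipticCurves`. Imports the previous `Proofs`
file and `ModularityVersionApProofs` (`p ∣ N_E ↔` bad reduction at `p`); nothing in the tree
imports this file (no cycle). The elementary existence theorems are stated for an arbitrary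
nonzero modulus `M` in place of `N`, resp. `pN`.
-/

set_option autoImplicit false

noncomputable section

open scoped Classical MatrixGroups ModularForm

open CongruenceSubgroup WeierstrassCurve IsDedekindDomain NumberField
  Literature.NumberTheory.EllipticCurves.ModularForms

namespace Literature.NumberTheory.EllipticCurves

/-! ### Kronecker-symbol bookkeeping -/

section Kronecker

/-- **A quadratic non-residue modulo an odd prime**, in Jacobi-symbol form: for an odd prime `ℓ`
there is `0 < n < ℓ` with `(n/ℓ) = -1` (half of the nonzero residues are non-squares;
Ireland–Rosen, Ch. 5 §1). [folklore] -/
theorem exists_nat_jacobiSym_eq_neg_one {ℓ : ℕ} (hℓ : ℓ.Prime) (hℓ2 : ℓ ≠ 2) :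
    ∃ n : ℕ, 0 < n ∧ n < ℓ ∧ jacobiSym n ℓ = -1 := by
  haveI : Fact ℓ.Prime := ⟨hℓ⟩
  have hchar : ringChar (ZMod ℓ) ≠ 2 := by
    rw [ZMod.ringChar_zmod_n]
    exact hℓ2
  obtain ⟨a, ha⟩ := FiniteField.exists_nonsquare hchar
  refine ⟨a.val, ?_, a.val_lt, ?_⟩
  · rw [Nat.pos_iff_ne_zero]
    intro h0
    apply ha
    rw [ZMod.val_eq_zero] at h0
    rw [h0]
    exact IsSquare.zero
  · rw [← jacobiSym.legendreSym.to_jacobiSym, legendreSym.eq_neg_one_iff]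
    simpa using ha

/-- The Jacobi symbol `(x/b)` of a natural number `x` only depends on `x mod b`
(Ireland–Rosen, Prop. 5.2.2). [folklore] -/
theorem jacobiSym_natCast_congr_of_modEq {x y b : ℕ} (h : x ≡ y [MOD b]) :
    jacobiSym x b = jacobiSym y b := by
  rw [jacobiSym.mod_left x, jacobiSym.mod_left y, ← Int.natCast_mod, ← Int.natCast_mod, h]

/-- `(a/ℓ) = 0` for a prime `ℓ ∣ a` (Ireland–Rosen, Ch. 5 §2). [folklore] -/
theorem jacobiSym_eq_zero_of_natCast_dvd {a : ℤ} {ℓ : ℕ} (hℓ : ℓ.Prime) (h : (ℓ : ℤ) ∣ a) :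
    jacobiSym a ℓ = 0 := by
  rw [jacobiSym.mod_left, Int.emod_eq_zero_of_dvd h, jacobiSym.zero_left hℓ.one_lt]

/-- If every odd prime `ℓ ∣ M` has `(d/ℓ) = 1` and `d ≡ 1 (mod 4)`, then `|d|` is prime to `2M`
(split primes are unramified: `(d/ℓ) = 1 ≠ 0` forces `ℓ ∤ d`). [folklore] -/
theorem natAbs_coprime_two_mul_of_kroneckerSplit {d : ℤ} (h4 : d % 4 = 1) {M : ℕ}
    (hspl : ∀ ℓ : ℕ, ℓ.Prime → ℓ ∣ M → (ℓ = 2 → d % 8 = 1) ∧ (ℓ ≠ 2 → jacobiSym d ℓ = 1)) :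
    d.natAbs.Coprime (2 * M) := by
  refine Nat.coprime_of_dvd fun k hk hkd hkM => ?_
  have hkd' : (k : ℤ) ∣ d := Int.natCast_dvd.mpr hkd
  by_cases hk2 : k = 2
  · subst hk2
    omega
  · have hkM' : k ∣ M := (hk.dvd_mul.mp hkM).resolve_left fun h =>
      hk2 ((Nat.prime_dvd_prime_iff_eq hk Nat.prime_two).mp h)
    have h1 := (hspl k hk hkM').2 hk2
    rw [jacobiSym_eq_zero_of_natCast_dvd hk hkd'] at h1
    exact zero_ne_one h1

end Kronecker

/-! ### Lemma 5.2.3: existence of the auxiliary discriminants (Dirichlet + CRT) -/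

section AuxiliaryFields

/-- **Burungale–Castella–Skinner, Lemma 5.2.3 — the imaginary quadratic field `K`, arithmetic
content.** For every nonzero `M` and every finite set `X` of integers there is a fundamental
discriminant `d_K ∉ X` with `d_K < 0`, `d_K ≡ 1 (mod 4)` squarefree (so `D_K = d_K` is odd),
`d_K ≠ -3` — (disc) — and every prime `ℓ ∣ M` split in `K = ℚ(√d_K)`: `d_K ≡ 1 (mod 8)` if
`ℓ = 2` and `(d_K/ℓ) = 1` if `ℓ` is odd — (Heeg) and (spl) for `M = pN`. Proof: `d_K = -q'` for a
prime `q' ≡ -1 (mod 8M)` (Dirichlet), so that `-q' ≡ 1` modulo `8` and modulo every `ℓ ∣ M`. The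
source (p. 10): "(spl), (Heeg), and (ii) hold for a positive proportion of imaginary quadratic
fields `K`, and we can fix one such `K` satisfying these conditions in addition to (disc)".
[cite: BurungaleCastellaSkinner2025, Lemma 5.2.3 (p. 10 of arXiv:2405.00270v2)] -/
theorem exists_auxiliaryImaginaryQuadraticDiscr (M : ℕ) (hM : M ≠ 0) (X : Finset ℤ) :
    ∃ dK : ℤ, dK ∉ X ∧ dK < 0 ∧ dK % 4 = 1 ∧ Squarefree dK ∧ dK ≠ -3 ∧
      ∀ ℓ : ℕ, ℓ.Prime → ℓ ∣ M → (ℓ = 2 → dK % 8 = 1) ∧ (ℓ ≠ 2 → jacobiSym dK ℓ = 1) := by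
  haveI : NeZero (8 * M) := ⟨mul_ne_zero (by norm_num) hM⟩
  obtain ⟨q, hqb, hq, hqmod⟩ :=
    Nat.forall_exists_prime_gt_and_eq_mod (q := 8 * M) (a := -1) isUnit_one.neg
      (X.sup Int.natAbs + 3)
  have hdvd : (8 * (M : ℤ)) ∣ (q : ℤ) + 1 := by
    have h0 : (((q : ℤ) + 1 : ℤ) : ZMod (8 * M)) = 0 := by
      push_cast
      rw [hqmod]
      ring
    have h := (ZMod.intCast_zmod_eq_zero_iff_dvd ((q : ℤ) + 1) (8 * M)).mp h0
    push_cast at h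
    exact h
  have h8 : (8 : ℤ) ∣ (q : ℤ) + 1 := (dvd_mul_right (8 : ℤ) (M : ℤ)).trans hdvd
  refine ⟨-(q : ℤ), ?_, ?_, ?_, ?_, ?_, ?_⟩
  · intro hx
    have := Finset.le_sup (f := Int.natAbs) hx
    simp only [Int.natAbs_neg, Int.natAbs_natCast] at this
    omega
  · have := hq.pos
    omega
  · omega
  · exact (Int.prime_iff_natAbs_prime.mpr (by simpa using hq)).squarefree
  · omega
  · intro ℓ hℓ hℓM
    refine ⟨fun _ => by omega, fun h2 => ?_⟩
    have hℓdvd : (ℓ : ℤ) ∣ (q : ℤ) + 1 :=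
      ((Int.natCast_dvd_natCast.mpr hℓM).trans (dvd_mul_left (M : ℤ) 8)).trans hdvd
    have hmod : (-(q : ℤ)) % (ℓ : ℤ) = (1 : ℤ) % (ℓ : ℤ) := by
      have : (-(q : ℤ)) ≡ 1 [ZMOD (ℓ : ℤ)] := by
        rw [Int.modEq_iff_dvd]
        simpa [sub_neg_eq_add, add_comm] using hℓdvd
      exact this
    rw [jacobiSym.mod_left, hmod, ← jacobiSym.mod_left, jacobiSym.one_left]

/-- **Burungale–Castella–Skinner, Lemma 5.2.3 — the real quadratic field `F`, arithmetic
content.** Let `p ≥ 5` be a prime, `M ≠ 0` with `p ∤ M` (in the application `M = N`, the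
conductor, and `p` is a good prime), `d_K ≠ 0` with `|d_K|` prime to `2pM` (the discriminant of
`K`, odd and unramified at `pN` by (disc), (Heeg), (spl)), and `X` a finite set of integers. Then
there is a fundamental discriminant `d_F ∉ X` with `d_F > 1`, `d_F ≡ 1 (mod 4)` squarefree (so
`D_F = d_F` is odd and `F = ℚ(√d_F)` is real quadratic) such that: (i) `p` is inert in `F`,
`(d_F/p) = -1`; (ii) every prime dividing `D_F` splits in `K`; (iii) every prime `ℓ ∣ M` is
inert in `F` if `ℓ ≡ -1 (mod p)` and split in `F` otherwise (in Kronecker form at `ℓ = 2` and at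
odd `ℓ`); (vi) `F ≠ ℚ(ζ₅)⁺ = ℚ(√5)` if `p = 5`. Proof: `d_F = q` for a prime `q ≡ 1 (mod 8)`,
`q ≡ 1 (mod |d_K|)` (so `(d_K/q) = (d_K/1) = 1` by the reciprocity law `jacobiSym.mod_right`),
`q` a non-residue mod `p`, and `q ≡ 1` or a non-residue mod each odd `ℓ ∣ M` according to (iii)
— one residue class modulo `8 p |d_K| ∏ ℓ` by the Chinese remainder theorem, containing
infinitely many primes by Dirichlet's theorem. The source (p. 10): "Since `p ∤ N` by hypothesis,
(i) and (iii) are independent splitting conditions which hold for a positive proportion of real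
quadratic fields `F`; fix one such `F` with odd discriminant `D_F`."
[cite: BurungaleCastellaSkinner2025, Lemma 5.2.3 (p. 10 of arXiv:2405.00270v2)] -/
theorem exists_auxiliaryRealQuadraticDiscr (p : ℕ) (hp : p.Prime) (hp5 : 5 ≤ p) (M : ℕ)
    (hM : M ≠ 0) (hpM : ¬ p ∣ M) (dK : ℤ) (hdK : dK ≠ 0)
    (hcop : dK.natAbs.Coprime (2 * p * M)) (X : Finset ℤ) :
    ∃ dF : ℤ, dF ∉ X ∧ 1 < dF ∧ dF % 4 = 1 ∧ Squarefree dF ∧ jacobiSym dF p = -1 ∧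
      (∀ ℓ : ℕ, ℓ.Prime → (ℓ : ℤ) ∣ dF → (ℓ = 2 → dK % 8 = 1) ∧ (ℓ ≠ 2 → jacobiSym dK ℓ = 1)) ∧
      (∀ ℓ : ℕ, ℓ.Prime → ℓ ∣ M →
        (p ∣ ℓ + 1 → (ℓ = 2 → dF % 8 = 5) ∧ (ℓ ≠ 2 → jacobiSym dF ℓ = -1)) ∧
        (¬ p ∣ ℓ + 1 → (ℓ = 2 → dF % 8 = 1) ∧ (ℓ ≠ 2 → jacobiSym dF ℓ = 1))) ∧
      (p = 5 → dF ≠ 5) := by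
  classical
  have hp2 : p ≠ 2 := by omega
  have hp0 : p ≠ 0 := hp.ne_zero
  have h2pM : 2 * p * M ≠ 0 := mul_ne_zero (mul_ne_zero two_ne_zero hp0) hM
  have hdK0 : dK.natAbs ≠ 0 := Int.natAbs_ne_zero.mpr hdK
  -- quadratic non-residues modulo odd primes
  have hnr : ∀ ℓ : ℕ, ∃ n : ℕ, ℓ.Prime → ℓ ≠ 2 → 0 < n ∧ n < ℓ ∧ jacobiSym n ℓ = -1 := by
    intro ℓ
    by_cases h : ℓ.Prime ∧ ℓ ≠ 2
    · obtain ⟨n, h1, h2, h3⟩ := exists_nat_jacobiSym_eq_neg_one h.1 h.2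
      exact ⟨n, fun _ _ => ⟨h1, h2, h3⟩⟩
    · exact ⟨1, fun h1 h2 => absurd ⟨h1, h2⟩ h⟩
  choose nr hnr using hnr
  have hnrcop : ∀ ℓ : ℕ, ℓ.Prime → ℓ ≠ 2 → (nr ℓ).Coprime ℓ := by
    intro ℓ hℓ hℓ2
    obtain ⟨h1, h2, -⟩ := hnr ℓ hℓ hℓ2
    exact (Nat.coprime_comm.mp ((Nat.Prime.coprime_iff_not_dvd hℓ).mpr
      (Nat.not_dvd_of_pos_of_lt h1 h2)))
  -- moduli `s` and residues `a`, indexed by `T = {0} ∪ {primes dividing 2pM}` (`0 ↦ |d_K|`)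
  set T : Finset ℕ := insert 0 (2 * p * M).primeFactors with hT
  set s : ℕ → ℕ := fun ℓ => if ℓ = 0 then dK.natAbs else if ℓ = 2 then 8 else ℓ with hs
  set a : ℕ → ℕ := fun ℓ => if ℓ = 0 then 1 else if ℓ = 2 then 1 else if ℓ = p then nr p
      else if p ∣ ℓ + 1 then nr ℓ else 1 with ha
  have hmemT : ∀ ℓ ∈ T, ℓ = 0 ∨ (ℓ.Prime ∧ ℓ ∣ 2 * p * M) := by
    intro ℓ hℓ
    rw [hT, Finset.mem_insert, Nat.mem_primeFactors] at hℓ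
    rcases hℓ with h | ⟨h1, h2, -⟩
    exacts [Or.inl h, Or.inr ⟨h1, h2⟩]
  have hmemT' : ∀ ℓ : ℕ, ℓ.Prime → ℓ ∣ 2 * p * M → ℓ ∈ T := by
    intro ℓ hℓ hdvd
    rw [hT, Finset.mem_insert, Nat.mem_primeFactors]
    exact Or.inr ⟨hℓ, hdvd, h2pM⟩
  have h0T : (0 : ℕ) ∈ T := by rw [hT]; exact Finset.mem_insert_self _ _
  have h2T : (2 : ℕ) ∈ T := hmemT' 2 Nat.prime_two ⟨p * M, by ring⟩
  have hpT : p ∈ T := hmemT' p hp ⟨2 * M, by ring⟩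
  -- values of `s` and `a`
  have hs0v : s 0 = dK.natAbs := by simp [hs]
  have hs2v : s 2 = 8 := by simp [hs]
  have hsℓ : ∀ ℓ : ℕ, ℓ ≠ 0 → ℓ ≠ 2 → s ℓ = ℓ := fun ℓ h0 h2 => by simp [hs, h0, h2]
  have ha0v : a 0 = 1 := by simp [ha]
  have ha2v : a 2 = 1 := by simp [ha]
  have hapv : a p = nr p := by simp [ha, hp0, hp2]
  have haℓ : ∀ ℓ : ℕ, ℓ ≠ 0 → ℓ ≠ 2 → ℓ ≠ p →
      a ℓ = if p ∣ ℓ + 1 then nr ℓ else 1 := fun ℓ h0 h2 h3 => by simp [ha, h0, h2, h3]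
  -- `|d_K|` is prime to the other moduli
  have hdK2 : dK.natAbs.Coprime 2 :=
    Nat.Coprime.coprime_dvd_right ⟨p * M, by ring⟩ hcop
  have hdK8 : dK.natAbs.Coprime 8 := by
    have := Nat.Coprime.pow_right 3 hdK2
    simpa using this
  have hdKℓ : ∀ ℓ : ℕ, ℓ ∣ 2 * p * M → dK.natAbs.Coprime ℓ := fun ℓ hℓ =>
    Nat.Coprime.coprime_dvd_right hℓ hcop
  -- the moduli are nonzero and pairwise coprime
  have hsne : ∀ ℓ ∈ T, s ℓ ≠ 0 := by
    intro ℓ hℓ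
    rcases hmemT ℓ hℓ with rfl | ⟨hℓp, -⟩
    · rwa [hs0v]
    · by_cases h2 : ℓ = 2
      · subst h2; rw [hs2v]; norm_num
      · rw [hsℓ ℓ hℓp.ne_zero h2]; exact hℓp.ne_zero
  have hcop8 : ∀ ℓ : ℕ, ℓ.Prime → ℓ ≠ 2 → Nat.Coprime 8 ℓ := by
    intro ℓ hℓ h2
    have : Nat.Coprime 2 ℓ := (Nat.coprime_primes Nat.prime_two hℓ).mpr (Ne.symm h2)
    simpa using Nat.Coprime.pow_left 3 this
  have hpair : (T : Set ℕ).Pairwise (Function.onFun Nat.Coprime s) := by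
    intro x hx y hy hxy
    simp only [Function.onFun]
    rcases hmemT x hx with rfl | ⟨hxp, hxd⟩ <;> rcases hmemT y hy with rfl | ⟨hyp, hyd⟩
    · exact absurd rfl hxy
    · rw [hs0v]
      by_cases hy2 : y = 2
      · subst hy2; rw [hs2v]; exact hdK8
      · rw [hsℓ y hyp.ne_zero hy2]; exact hdKℓ y hyd
    · rw [hs0v]
      by_cases hx2 : x = 2
      · subst hx2; rw [hs2v]; exact hdK8.symm
      · rw [hsℓ x hxp.ne_zero hx2]; exact (hdKℓ x hxd).symm
    · by_cases hx2 : x = 2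
      · subst hx2
        have hy2 : y ≠ 2 := fun h => hxy h.symm
        rw [hs2v, hsℓ y hyp.ne_zero hy2]
        exact hcop8 y hyp hy2
      · by_cases hy2 : y = 2
        · subst hy2
          rw [hs2v, hsℓ x hxp.ne_zero hx2]
          exact (hcop8 x hxp hx2).symm
        · rw [hsℓ x hxp.ne_zero hx2, hsℓ y hyp.ne_zero hy2]
          exact (Nat.coprime_primes hxp hyp).mpr hxy
  -- Chinese remainder theorem, then Dirichlet's theorem
  obtain ⟨k, hk⟩ := Nat.chineseRemainderOfFinset a s T hsne hpair
  set Q : ℕ := ∏ ℓ ∈ T, s ℓ with hQ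
  have hQ0 : Q ≠ 0 := Finset.prod_ne_zero_iff.mpr hsne
  haveI : NeZero Q := ⟨hQ0⟩
  have hacop : ∀ ℓ ∈ T, (a ℓ).Coprime (s ℓ) := by
    intro ℓ hℓ
    rcases hmemT ℓ hℓ with rfl | ⟨hℓp, hℓd⟩
    · rw [ha0v]; exact Nat.coprime_one_left _
    · by_cases h2 : ℓ = 2
      · subst h2; rw [ha2v]; exact Nat.coprime_one_left _
      · rw [hsℓ ℓ hℓp.ne_zero h2]
        by_cases h3 : ℓ = p
        · subst h3; rw [hapv]; exact hnrcop ℓ hℓp h2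
        · rw [haℓ ℓ hℓp.ne_zero h2 h3]
          split_ifs
          · exact hnrcop ℓ hℓp h2
          · exact Nat.coprime_one_left _
  have hkQ : k.Coprime Q := by
    refine Nat.Coprime.prod_right fun ℓ hℓ => ?_
    have h := (hk ℓ hℓ).gcd_eq
    unfold Nat.Coprime
    rw [h]
    exact hacop ℓ hℓ
  obtain ⟨q, hqb, hq, hqmod⟩ :=
    Nat.forall_exists_prime_gt_and_eq_mod (q := Q) (a := (k : ZMod Q))
      ((ZMod.isUnit_iff_coprime k Q).mpr hkQ) (X.sup Int.natAbs + 5)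
  have hqk : q ≡ k [MOD Q] := (ZMod.natCast_eq_natCast_iff _ _ _).mp hqmod
  have hmods : ∀ ℓ ∈ T, q ≡ a ℓ [MOD s ℓ] := fun ℓ hℓ =>
    (hqk.of_dvd (Finset.dvd_prod_of_mem s hℓ)).trans (hk ℓ hℓ)
  -- consequences of the congruences
  have hq8 : q % 8 = 1 := by
    have h := hmods 2 h2T
    rw [hs2v, ha2v] at h
    exact h
  have hqodd : Odd q := Nat.odd_iff.mpr (by omega)
  have hqdK : q % (4 * dK.natAbs) = 1 := by
    have h1 : q ≡ 1 [MOD dK.natAbs] := by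
      have h := hmods 0 h0T
      rwa [hs0v, ha0v] at h
    have h2 : q ≡ 1 [MOD 8] := hq8
    have h3 : q ≡ 1 [MOD 8 * dK.natAbs] :=
      (Nat.modEq_and_modEq_iff_modEq_mul hdK8.symm).mp ⟨h2, h1⟩
    have h4 : q ≡ 1 [MOD 4 * dK.natAbs] := h3.of_dvd (mul_dvd_mul_right (by norm_num) _)
    rw [h4]
    exact Nat.mod_eq_of_lt (by omega)
  have hqp : jacobiSym (q : ℤ) p = -1 := by
    have h := hmods p hpT
    rw [hsℓ p hp0 hp2, hapv] at h
    rw [jacobiSym_natCast_congr_of_modEq h]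
    exact (hnr p hp hp2).2.2
  refine ⟨(q : ℤ), ?_, by exact_mod_cast hq.one_lt, by omega,
    Int.squarefree_natCast.mpr hq.prime.squarefree, hqp, ?_, ?_, ?_⟩
  · -- `d_F ∉ X`
    intro hx
    have := Finset.le_sup (f := Int.natAbs) hx
    simp only [Int.natAbs_natCast] at this
    omega
  · -- (ii): the primes dividing `D_F = q` split in `K`
    intro ℓ hℓ hℓq
    have hℓq' : ℓ = q :=
      (Nat.prime_dvd_prime_iff_eq hℓ hq).mp (Int.natCast_dvd_natCast.mp hℓq)
    subst hℓq'
    refine ⟨fun h2 => by omega, fun _ => ?_⟩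
    rw [jacobiSym.mod_right dK hqodd, hqdK, jacobiSym.one_right]
  · -- (iii): the primes `ℓ ∣ M` in `F`
    intro ℓ hℓ hℓM
    have hℓT : ℓ ∈ T := hmemT' ℓ hℓ (dvd_mul_of_dvd_right hℓM _)
    by_cases h2 : ℓ = 2
    · subst h2
      have hp3 : ¬ p ∣ 2 + 1 := fun h => by
        have := Nat.le_of_dvd (by norm_num) h
        omega
      exact ⟨fun h => absurd h hp3, fun _ => ⟨fun _ => by omega, fun h => absurd rfl h⟩⟩
    · have hℓp : ℓ ≠ p := by
        rintro rfl
        exact hpM hℓM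
      have h := hmods ℓ hℓT
      rw [hsℓ ℓ hℓ.ne_zero h2, haℓ ℓ hℓ.ne_zero h2 hℓp] at h
      refine ⟨fun hd => ⟨fun h' => absurd h' h2, fun _ => ?_⟩,
        fun hd => ⟨fun h' => absurd h' h2, fun _ => ?_⟩⟩
      · rw [if_pos hd] at h
        rw [jacobiSym_natCast_congr_of_modEq h]
        exact (hnr ℓ hℓ h2).2.2
      · rw [if_neg hd] at h
        rw [jacobiSym_natCast_congr_of_modEq h]
        exact_mod_cast jacobiSym.one_left ℓ
  · -- (vi)
    rintro rfl
    have : 5 < q := by omega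
    omega

end AuxiliaryFields

/-! ### Thm. 1.1.2 (a) from Prop. 5.2.1, Kato and modularity -/

/-- **Burungale–Castella–Skinner, Thm. 1.1.2 (a), from Prop. 5.2.1 (with the descent
(5.2) ⟹ (5.3)), Kato's theorem and modularity, the auxiliary fields being CONSTRUCTED**
("Proof of Theorem 1.1.2", p. 10 of arXiv:2405.00270v2, with Lemma 5.2.3 proved above). Assume:
* `hkato` — Kato's theorem for every elliptic curve over `ℚ` (the tree's named fact
  `kato_divisibility`, Kato 2004, Thm. 17.4 = display (5.4));
* `hmod` — modularity of elliptic curves over `ℚ` (the tree's named fact `exists_isNewformOf`),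
  used to attach newforms `g_K, g_F, g_{FK}` to the three quadratic twists;
* `h521` — **Prop. 5.2.1 ⟹ display (5.3), as printed, for all auxiliary pairs `(K, F)` outside
  finite exceptional sets.** For `E/ℚ` (globally minimal `W`, conductor `N = W.conductorNorm ℤ`),
  `p ≥ 5` good ordinary, `E[p]` irreducible, `κ, γ` cyclotomic as in the named fact and `f = g` the
  newform of `E`: there is a finite set `X₁ ⊂ ℤ` such that for every `d_K ∉ X₁` with `d_K < 0`,
  `d_K ≡ 1 (mod 4)` squarefree, `d_K ≠ -3` ((disc): `D_K = d_K` odd, `≠ -3`) and every prime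
  `ℓ ∣ pN` split in `K = ℚ(√d_K)` ((Heeg), (spl); Kronecker form: `d_K ≡ 1 (mod 8)` if `ℓ = 2`,
  `(d_K/ℓ) = 1` if `ℓ` odd), there is a finite set `X₂ ⊂ ℤ` such that for every `d_F ∉ X₂` with
  `d_F > 1`, `d_F ≡ 1 (mod 4)` squarefree (`F = ℚ(√d_F)` real quadratic, `D_F = d_F` odd),
  (i) `(d_F/p) = -1`, (ii) every prime dividing `d_F` split in `K`, (iii) every prime `ℓ ∣ N`
  inert in `F` if `ℓ ≡ -1 (mod p)` and split otherwise (Kronecker form), (vi) `d_F ≠ 5` if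
  `p = 5`: for all globally minimal models `W₁, W₂, W₃` of the twists of `E` by
  `d_K, d_F, d_K d_F` (`∃ C, C • Wᵢ = W.quadraticTwist d`), their newforms
  `f₁ = g_K, f₂ = g_F, f₃ = g_{FK}` and Pontryagin-dual data `D, D₁, D₂, D₃` over `(κ, γ)`,
  `(L_p(g) L_p(g_K) L_p(g_F) L_p(g_{FK})) ⊇ ch X(g) · ch X(g_K) · ch X(g_F) · ch X(g_{FK})` in
  `Λ ⊗ ℚ_p` (spelled with explicit powers of `p` as in `PAdicBSD`: `ι G = p^n ∏ L_p`,
  `p^m ∏ ch ⊆ (G)`). The exceptional sets carry the Galois-theoretic hypotheses (irr_K), (iv),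
  (v) of Prop. 5.2.1, which by the proof of Lemma 5.2.3 fail for at most finitely many `K` and,
  given `K`, finitely many `F` (module docstring); so `h521` is implied by Prop. 5.2.1 with
  [CGS23, Prop. 1.2.4] and [SU14, Props. 3.6, 3.9] and is the part of the source not in the tree.
Then the named fact `burungale_castella_skinner_charIdeal_eq_padicLFunction` holds. Proof, as
printed: `p ∤ N` (good reduction); choose `d_K ∉ X₁` by `exists_auxiliaryImaginaryQuadraticDiscr`
(modulus `pN`) and then `d_F ∉ X₂` by `exists_auxiliaryRealQuadraticDiscr` (modulus `N`; `|d_K|`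
is prime to `2pN` by `natAbs_coprime_two_mul_of_kroneckerSplit`); take globally minimal models of
the three twists, good ordinary at `p` since `p ∤ 2 d_K d_F`, their newforms (`hmod`) and Selmer
data; apply (5.4) = `hkato` to the four curves and (5.3) = `h521`; "a proper divisibility in (5.4)
would contradict (5.3)" is `exists_span_eq_and_map_eq_C_zpow_mul_of_prod_mem` over `Fin 4`.
[cite: BurungaleCastellaSkinner2025, Thm. 1.1.2 (a), Prop. 5.2.1, Lemma 5.2.3 and display (5.3) (pp. 2, 9–10 of arXiv:2405.00270v2)] -/
theorem burungale_castella_skinner_charIdeal_eq_padicLFunction_of_prop521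
    (hkato : ∀ (W : WeierstrassCurve ℚ) [W.IsElliptic] [W.IsGloballyMinimal] (p : ℕ) [Fact p.Prime]
      (κ : ZpExtension ℚ p) (γ : Field.absoluteGaloisGroup ℚ) (N : ℕ) [NeZero N]
      (f : CuspForm (Gamma0 N) 2), kato_divisibility W p (κ := κ) (γ := γ) (f := f))
    (hmod : exists_isNewformOf)
    (h521 : ∀ (W : WeierstrassCurve ℚ) [W.IsElliptic] [W.IsGloballyMinimal] (p : ℕ) [Fact p.Prime]
      (κ : ZpExtension ℚ p) (γ : Field.absoluteGaloisGroup ℚ) {N : ℕ} [NeZero N]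
      (f : CuspForm (Gamma0 N) 2)
      (hp : 5 ≤ p) (hgood : W.HasGoodReductionAtPrime p) (hord : ¬ (p : ℤ) ∣ W.frobeniusTrace p)
      (hirr : W.HasIrreducibleModPGaloisRep p) (hκ : κ.IsCyclotomic) (hγ : κ.IsTopGenerator γ)
      (hγ' : IsCyclotomicVariable p γ) (hf : IsNewformOf W f),
      ∃ X₁ : Finset ℤ, ∀ dK : ℤ, dK ∉ X₁ → dK < 0 → dK % 4 = 1 → Squarefree dK → dK ≠ -3 →
        (∀ ℓ : ℕ, ℓ.Prime → ℓ ∣ p * W.conductorNorm ℤ →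
          (ℓ = 2 → dK % 8 = 1) ∧ (ℓ ≠ 2 → jacobiSym dK ℓ = 1)) →
        ∃ X₂ : Finset ℤ, ∀ dF : ℤ, dF ∉ X₂ → 1 < dF → dF % 4 = 1 → Squarefree dF →
          jacobiSym dF p = -1 →
          (∀ ℓ : ℕ, ℓ.Prime → (ℓ : ℤ) ∣ dF →
            (ℓ = 2 → dK % 8 = 1) ∧ (ℓ ≠ 2 → jacobiSym dK ℓ = 1)) →
          (∀ ℓ : ℕ, ℓ.Prime → ℓ ∣ W.conductorNorm ℤ →
            (p ∣ ℓ + 1 → (ℓ = 2 → dF % 8 = 5) ∧ (ℓ ≠ 2 → jacobiSym dF ℓ = -1)) ∧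
            (¬ p ∣ ℓ + 1 → (ℓ = 2 → dF % 8 = 1) ∧ (ℓ ≠ 2 → jacobiSym dF ℓ = 1))) →
          (p = 5 → dF ≠ 5) →
          ∀ (W₁ W₂ W₃ : WeierstrassCurve ℚ) [W₁.IsElliptic] [W₁.IsGloballyMinimal]
            [W₂.IsElliptic] [W₂.IsGloballyMinimal] [W₃.IsElliptic] [W₃.IsGloballyMinimal]
            (h₁ : ∃ C : VariableChange ℚ, C • W₁ = W.quadraticTwist (dK : ℚ))
            (h₂ : ∃ C : VariableChange ℚ, C • W₂ = W.quadraticTwist (dF : ℚ))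
            (h₃ : ∃ C : VariableChange ℚ, C • W₃ = W.quadraticTwist ((dK * dF : ℤ) : ℚ))
            {N₁ N₂ N₃ : ℕ} [NeZero N₁] [NeZero N₂] [NeZero N₃]
            (f₁ : CuspForm (Gamma0 N₁) 2) (f₂ : CuspForm (Gamma0 N₂) 2)
            (f₃ : CuspForm (Gamma0 N₃) 2)
            (hf₁ : IsNewformOf W₁ f₁) (hf₂ : IsNewformOf W₂ f₂) (hf₃ : IsNewformOf W₃ f₃)
            (D : W.SelmerDualData κ γ) (D₁ : W₁.SelmerDualData κ γ) (D₂ : W₂.SelmerDualData κ γ)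
            (D₃ : W₃.SelmerDualData κ γ),
            ∃ (m n : ℕ) (G : IwasawaAlgebra p),
              iwasawaToPowerSeries p G =
                  PowerSeries.C ((p : ℚ_[p]) ^ n) *
                    (padicLFunction f (unitRoot W p : ℚ_[p]) *
                      padicLFunction f₁ (unitRoot W₁ p : ℚ_[p]) *
                      padicLFunction f₂ (unitRoot W₂ p : ℚ_[p]) *
                      padicLFunction f₃ (unitRoot W₃ p : ℚ_[p])) ∧
                Ideal.span {PowerSeries.C ((p : ℤ_[p]) ^ m)} *
                    (D.charIdeal * D₁.charIdeal * D₂.charIdeal * D₃.charIdeal) ≤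
                  Ideal.span {G}) :
    burungale_castella_skinner_charIdeal_eq_padicLFunction := by
  intro W _ _ p _ κ γ N _ f hp hgood hord hirr hκ hγ hγ' hf D
  have hp2 : p ≠ 2 := by omega
  have hpP : p.Prime := Fact.out
  have hpZ : Prime (p : ℤ) := Nat.prime_iff_prime_int.mp hpP
  -- the conductor `N = N_E` and `p ∤ N`
  have hNE : 0 < W.conductorNorm ℤ := conductorNorm_pos_holds W
  have hpNE : ¬ p ∣ W.conductorNorm ℤ := fun h =>
    (W.dvd_conductorNorm_iff_not_hasGoodReductionAtPrime p).mp h hgood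
  -- Lemma 5.2.3: the field `K`
  obtain ⟨X₁, H₁⟩ := h521 W p κ γ f hp hgood hord hirr hκ hγ hγ' hf
  obtain ⟨dK, hKX, hK0, hK4, hKsq, hK3, hKspl⟩ :=
    exists_auxiliaryImaginaryQuadraticDiscr (p * W.conductorNorm ℤ)
      (mul_ne_zero hpP.ne_zero hNE.ne') X₁
  obtain ⟨X₂, H₂⟩ := H₁ dK hKX hK0 hK4 hKsq hK3 hKspl
  -- Lemma 5.2.3: the field `F`
  have hKcop : dK.natAbs.Coprime (2 * p * W.conductorNorm ℤ) := by
    rw [mul_assoc]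
    exact natAbs_coprime_two_mul_of_kroneckerSplit hK4 hKspl
  obtain ⟨dF, hFX, hF1, hF4, hFsq, hFp, hFii, hFiii, hFvi⟩ :=
    exists_auxiliaryRealQuadraticDiscr p hpP hp (W.conductorNorm ℤ) hNE.ne' hpNE dK hK0.ne
      hKcop X₂
  have H := H₂ dF hFX hF1 hF4 hFsq hFp hFii hFiii hFvi
  -- `p ∤ d_K`, `p ∤ d_F`, `p ∤ d_K d_F`, `(d_K, d_F) = 1`
  have hKp : jacobiSym dK p = 1 := (hKspl p hpP (dvd_mul_right p _)).2 hp2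
  have hpK : ¬ (p : ℤ) ∣ dK := fun h => by
    rw [jacobiSym_eq_zero_of_natCast_dvd hpP h] at hKp
    exact zero_ne_one hKp
  have hpF : ¬ (p : ℤ) ∣ dF := fun h => by
    rw [jacobiSym_eq_zero_of_natCast_dvd hpP h] at hFp
    exact one_ne_zero (neg_eq_zero.mp hFp.symm)
  have hpKF : ¬ (p : ℤ) ∣ dK * dF := fun h => (hpZ.dvd_or_dvd h).elim hpK hpF
  have hKF : IsCoprime dK dF := by
    rw [Int.isCoprime_iff_gcd_eq_one, Int.gcd_eq_natAbs]
    refine Nat.coprime_of_dvd fun k hk hkK hkF => ?_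
    have hkF' : (k : ℤ) ∣ dF := Int.natCast_dvd.mpr hkF
    have hkK' : (k : ℤ) ∣ dK := Int.natCast_dvd.mpr hkK
    have hk2 : k ≠ 2 := by
      rintro rfl
      have h2 : (2 : ℤ) ∣ dF := by exact_mod_cast hkF'
      omega
    have h1 := (hFii k hk hkF').2 hk2
    rw [jacobiSym_eq_zero_of_natCast_dvd hk hkK'] at h1
    exact zero_ne_one h1
  have hKFsq : Squarefree (dK * dF) := squarefree_mul_iff.mpr ⟨hKF.isRelPrime, hKsq, hFsq⟩
  have hF0 : dF ≠ 0 := by omega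
  have hK0' : (dK : ℚ) ≠ 0 := by exact_mod_cast hK0.ne
  have hF0' : (dF : ℚ) ≠ 0 := by exact_mod_cast hF0
  have hKF0' : ((dK * dF : ℤ) : ℚ) ≠ 0 := by exact_mod_cast mul_ne_zero hK0.ne hF0
  -- globally minimal models of the three twists, good ordinary at `p`
  obtain ⟨W₁, hE₁, hM₁, C₁, hC₁⟩ := exists_isGloballyMinimal_smul_eq_quadraticTwist W hK0'
  obtain ⟨W₂, hE₂, hM₂, C₂, hC₂⟩ := exists_isGloballyMinimal_smul_eq_quadraticTwist W hF0'
  obtain ⟨W₃, hE₃, hM₃, C₃, hC₃⟩ := exists_isGloballyMinimal_smul_eq_quadraticTwist W hKF0'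
  have hW : IsOrdinaryAt W p := ⟨hgood, hord⟩
  have hord₁ : IsOrdinaryAt W₁ p := isOrdinaryAt_of_smul_eq_quadraticTwist W W₁ hKsq hC₁ p hp2 hpK hW
  have hord₂ : IsOrdinaryAt W₂ p := isOrdinaryAt_of_smul_eq_quadraticTwist W W₂ hFsq hC₂ p hp2 hpF hW
  have hord₃ : IsOrdinaryAt W₃ p :=
    isOrdinaryAt_of_smul_eq_quadraticTwist W W₃ hKFsq hC₃ p hp2 hpKF hW
  -- their newforms (modularity) and Selmer data
  have hN₁ : 0 < W₁.conductorNorm ℤ := conductorNorm_pos_holds W₁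
  have hN₂ : 0 < W₂.conductorNorm ℤ := conductorNorm_pos_holds W₂
  have hN₃ : 0 < W₃.conductorNorm ℤ := conductorNorm_pos_holds W₃
  haveI : NeZero (W₁.conductorNorm ℤ) := ⟨hN₁.ne'⟩
  haveI : NeZero (W₂.conductorNorm ℤ) := ⟨hN₂.ne'⟩
  haveI : NeZero (W₃.conductorNorm ℤ) := ⟨hN₃.ne'⟩
  obtain ⟨f₁, hf₁⟩ := hmod W₁
  obtain ⟨f₂, hf₂⟩ := hmod W₂
  obtain ⟨f₃, hf₃⟩ := hmod W₃
  set D₁ : W₁.SelmerDualData κ γ := W₁.selmerDualData κ hγ with hD₁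
  set D₂ : W₂.SelmerDualData κ γ := W₂.selmerDualData κ hγ with hD₂
  set D₃ : W₃.SelmerDualData κ γ := W₃.selmerDualData κ hγ with hD₃
  -- (5.3)
  obtain ⟨m, n, G, hιG, hG⟩ :=
    H W₁ W₂ W₃ ⟨C₁, hC₁⟩ ⟨C₂, hC₂⟩ ⟨C₃, hC₃⟩ f₁ f₂ f₃ hf₁ hf₂ hf₃ D D₁ D₂ D₃
  -- (5.4) for the four curves
  obtain ⟨ht₀, ⟨a₀, k₀, hk₀, hι₀⟩, -⟩ := hkato W p κ γ N f hp2 hW hκ hγ hγ' hf D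
  obtain ⟨-, ⟨a₁, k₁, hk₁, hι₁⟩, -⟩ := hkato W₁ p κ γ _ f₁ hp2 hord₁ hκ hγ hγ' hf₁ D₁
  obtain ⟨-, ⟨a₂, k₂, hk₂, hι₂⟩, -⟩ := hkato W₂ p κ γ _ f₂ hp2 hord₂ hκ hγ hγ' hf₂ D₂
  obtain ⟨-, ⟨a₃, k₃, hk₃, hι₃⟩, -⟩ := hkato W₃ p κ γ _ f₃ hp2 hord₃ hκ hγ hγ' hf₃ D₃
  -- generators of the four characteristic ideals
  obtain ⟨c₀, hc₀, hc₀0⟩ := exists_charIdeal_eq_span_singleton p D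
  obtain ⟨c₁, hc₁, hc₁0⟩ := exists_charIdeal_eq_span_singleton p D₁
  obtain ⟨c₂, hc₂, hc₂0⟩ := exists_charIdeal_eq_span_singleton p D₂
  obtain ⟨c₃, hc₃, hc₃0⟩ := exists_charIdeal_eq_span_singleton p D₃
  rw [hc₀] at hk₀
  rw [hc₁] at hk₁
  rw [hc₂] at hk₂
  rw [hc₃] at hk₃
  -- "a proper divisibility in (5.4) would contradict (5.3)": the algebra over `Fin 4`
  set g : Fin 4 → IwasawaAlgebra p := ![c₀, c₁, c₂, c₃] with hgdef
  set g₁ : Fin 4 → IwasawaAlgebra p := ![k₀, k₁, k₂, k₃] with hg₁def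
  set L : Fin 4 → PowerSeries ℚ_[p] :=
    ![padicLFunction f (unitRoot W p : ℚ_[p]), padicLFunction f₁ (unitRoot W₁ p : ℚ_[p]),
      padicLFunction f₂ (unitRoot W₂ p : ℚ_[p]), padicLFunction f₃ (unitRoot W₃ p : ℚ_[p])]
    with hLdef
  set a : Fin 4 → ℕ := ![a₀, a₁, a₂, a₃] with hadef
  have hg0 : ∀ i ∈ (Finset.univ : Finset (Fin 4)), g i ≠ 0 := by
    intro i _
    fin_cases i
    · simpa [hgdef] using hc₀0
    · simpa [hgdef] using hc₁0
    · simpa [hgdef] using hc₂0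
    · simpa [hgdef] using hc₃0
  have hgg₁ : ∀ i ∈ (Finset.univ : Finset (Fin 4)), g₁ i ∈ Ideal.span {g i} := by
    intro i _
    fin_cases i
    · simpa [hgdef, hg₁def] using hk₀
    · simpa [hgdef, hg₁def] using hk₁
    · simpa [hgdef, hg₁def] using hk₂
    · simpa [hgdef, hg₁def] using hk₃
  have hιg₁ : ∀ i ∈ (Finset.univ : Finset (Fin 4)),
      iwasawaToPowerSeries p (g₁ i) = PowerSeries.C ((p : ℚ_[p]) ^ a i) * L i := by
    intro i _
    fin_cases i
    · simpa [hg₁def, hLdef, hadef] using hι₀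
    · simpa [hg₁def, hLdef, hadef] using hι₁
    · simpa [hg₁def, hLdef, hadef] using hι₂
    · simpa [hg₁def, hLdef, hadef] using hι₃
  have hprodg : ∏ i ∈ (Finset.univ : Finset (Fin 4)), g i = c₀ * c₁ * c₂ * c₃ := by
    rw [Fin.prod_univ_four]
    simp [hgdef]
  have hprodL : ∏ i ∈ (Finset.univ : Finset (Fin 4)), L i =
      padicLFunction f (unitRoot W p : ℚ_[p]) * padicLFunction f₁ (unitRoot W₁ p : ℚ_[p]) *
        padicLFunction f₂ (unitRoot W₂ p : ℚ_[p]) * padicLFunction f₃ (unitRoot W₃ p : ℚ_[p]) := by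
    rw [Fin.prod_univ_four]
    simp [hLdef]
  have hGmem : PowerSeries.C ((p : ℤ_[p]) ^ m) * ∏ i ∈ (Finset.univ : Finset (Fin 4)), g i ∈
      Ideal.span {G} := by
    rw [hprodg]
    refine hG (Ideal.mul_mem_mul (Ideal.mem_span_singleton_self _) ?_)
    refine Ideal.mul_mem_mul (Ideal.mul_mem_mul (Ideal.mul_mem_mul ?_ ?_) ?_) ?_
    · rw [hc₀]; exact Ideal.mem_span_singleton_self _
    · rw [hc₁]; exact Ideal.mem_span_singleton_self _
    · rw [hc₂]; exact Ideal.mem_span_singleton_self _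
    · rw [hc₃]; exact Ideal.mem_span_singleton_self _
  have hιG' : iwasawaToPowerSeries p G =
      PowerSeries.C ((p : ℚ_[p]) ^ n) * ∏ i ∈ (Finset.univ : Finset (Fin 4)), L i := by
    rw [hprodL, hιG]
  obtain ⟨g', k, hspan, hι⟩ := exists_span_eq_and_map_eq_C_zpow_mul_of_prod_mem p hg0 hgg₁ hιg₁
    hGmem hιG' (i := 0) (Finset.mem_univ _)
  refine ⟨ht₀, g', k, ?_, ?_⟩
  · rw [hc₀, ← hspan]
    simp [hgdef]
  · rw [hι]
    simp [hLdef]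

end Literature.NumberTheory.EllipticCurves

end
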